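import Mathlib
import Literature.Computability.AlgebraicComplexity.BorderApolarityGeneric
import Literature.Computability.AlgebraicComplexity.BorderApolarityWeak
import Literature.Computability.AlgebraicComplexity.BorderApolarityLimits
import Summits.MatrixMultiplication.MatrixMultiplication.Theorems.FidelityWitnessesFidelityGapThreeSeventeenDefs
import Summits.MatrixMultiplication.MatrixMultiplication.Theorems.FidelityWitnessesFidelityGapThreeSeventeenStubFatBorderApolarityRank

/-!
# `FidelityWitnesses.FidelityGapThreeSeventeen` (stmt-MatrixMultiplication-4958), line
# `symbolic-square-border-apolarity`: stub `stub_fatBorderApolarity` — FAT BORDER APOLARITY truncated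
# at total degree `4`

**Theorem (`stub_fatBorderApolarity`).** For every tensor `t : P3 → P3 → P3 → ℂ`, every `r` and every
configuration `x` of `r` points of `A' × B' × C'` in general position (`GeneralConfiguration r x`),
`R̲(t) ≤ r` (algebraic border rank over `ℂ[ε]`) yields a fat border-apolarity candidate
`IsFatCandidate t r I`.

Proof (Buczyńska–Buczyński / Conner–Harper–Landsberg border apolarity made elementary, as in the tree's
`BorderApolarityWeak/Generic`, run in all multidegrees of total degree `≤ 4`, plus the symbolic-square
layer). `R̲(t) ≤ r` gives an order-`h` approximate decomposition with `r` triads over `ℂ[ε]`; its moving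
points `q_ρ(ε)` are PERTURBED to `p_ρ = q_ρ + ε^M x_ρ` (`M > h` and beyond all degrees; the decomposition
survives, `isApproxDecomposition_add_X_pow_mul`). Put `I m := lim_{ε→0} I(Γ_ε)_m` (`FatBorder.Ilim`).
(deg) `dim I_m + r = dim S_m` (`finrank_Ilim_add`: the top `ε`-coefficients of values at `p_ρ` are values
at `x_ρ`, which impose `r` independent conditions); (apolar) a `(1,1,1)`-form vanishing at the moving
points pairs to zero with `t` in the limit (`tPair_eq_zero_of_mem_Ilim`), and the other three apolarity
conditions reduce to it through (mult); (mult) `I_d · S_e ≤ I_{d+e}` (`Ilim_mul_le`); (room) the products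
lie in `I_{m'}`, `|m'| = 4`, of codimension `r`; (fat) `I_d · I_e ≤ J_{d+e} = lim I(2Γ_ε)_{d+e}` (Leibniz,
`Ilim_mul_Ilim_le`) and `dim J_{m'} + 17r ≤ dim S_{m'}` (resp. `25r`) from the double-point genericity of
`x` (`finrank_Jlim_add_le`).

References: W. Buczyńska, J. Buczyński, Duke Math. J. 170 (2021), Thm. 1.2; A. Conner, A. Harper,
J. M. Landsberg, Forum Math. Pi 11 (2023) e17 = arXiv:1911.07981, §2.3 (i)–(iii), §3.
-/

noncomputable section

namespace Summit.MatrixMultiplication.MatrixMultiplication.Theorems.SymbolicSquare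

-- single-conjunct summit: the `Summit.<S>.<P>` prefix repeats `MatrixMultiplication` by design (D-0017)
set_option linter.dupNamespace false

open scoped BigOperators Polynomial
open Polynomial Module
open Literature.Computability.AlgebraicComplexity
open FatBorder

/-! ## The grading of `Poly` is a block grading; the `(1,1,1)`-monomials -/

/-- Every variable has total weight `1`. [folklore] -/
theorem sum_wt (v : Var) : ∑ l, wt v l = 1 := by
  simp [wt, Finset.sum_pi_single']

/-- The `l`-th component of the weight of a monomial is its degree in the slot-`l` variables.
[folklore] -/
theorem weight_wt_apply (d : Var →₀ ℕ) (l : Fin 3) : Finsupp.weight wt d l = ∑ q : P3, d (l, q) := by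
  classical
  rw [Finsupp.weight_apply, Finsupp.sum_fintype _ _ (by simp), Finset.sum_apply, Fintype.sum_prod_type,
    Finset.sum_eq_single l]
  · refine Finset.sum_congr rfl fun q _ => ?_
    simp [wt]
  · intro l' _ hl'
    refine Finset.sum_eq_zero fun q _ => ?_
    simp [wt, Ne.symm hl']
  · intro h; exact absurd (Finset.mem_univ l) h

/-- A finite family of naturals summing to `1` is a Kronecker delta. [folklore] -/
theorem exists_of_sum_eq_one {α : Type*} [Fintype α] [DecidableEq α] {f : α → ℕ}
    (h : ∑ q, f q = 1) : ∃ q₀, ∀ q, f q = if q = q₀ then 1 else 0 := by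
  obtain ⟨q₀, -, hq₀⟩ : ∃ q₀ ∈ Finset.univ, f q₀ ≠ 0 :=
    Finset.exists_ne_zero_of_sum_ne_zero (by rw [h]; exact one_ne_zero)
  refine ⟨q₀, fun q => ?_⟩
  have hsplit := Finset.add_sum_erase Finset.univ f (Finset.mem_univ q₀)
  rw [h] at hsplit
  have h0 : ∑ x ∈ Finset.univ.erase q₀, f x = 0 := by omega
  split_ifs with hq
  · subst hq; omega
  · exact Finset.sum_eq_zero_iff.1 h0 q (Finset.mem_erase.2 ⟨hq, Finset.mem_univ q⟩)

/-- The `(1,1,1)`-monomial `z_a x_b y_c` (the exponent vector used by `tPair`). -/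
local notation "μ[" a ", " b ", " c "]" =>
  (Finsupp.single ((2 : Fin 3), a) 1 + Finsupp.single ((0 : Fin 3), b) 1 +
    Finsupp.single ((1 : Fin 3), c) 1 : Var →₀ ℕ)

/-- Exponents of `z_a x_b y_c`. [folklore] -/
theorem mono_apply (a b c : P3) (l : Fin 3) (q : P3) :
    μ[a, b, c] (l, q) = (if l = 2 ∧ q = a then 1 else 0) + (if l = 0 ∧ q = b then 1 else 0) +
      (if l = 1 ∧ q = c then 1 else 0) := by
  simp only [Finsupp.coe_add, Pi.add_apply, Finsupp.single_apply, Prod.mk.injEq]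
  congr 1
  · congr 1 <;> exact if_congr (by tauto) rfl rfl
  · exact if_congr (by tauto) rfl rfl

/-- `(a, b, c) ↦ z_a x_b y_c` is injective. [folklore] -/
theorem mono_injective {a b c a' b' c' : P3} (h : μ[a, b, c] = μ[a', b', c']) :
    a = a' ∧ b = b' ∧ c = c' := by
  have h2 := congrArg (fun d => d ((2 : Fin 3), a)) h
  have h0 := congrArg (fun d => d ((0 : Fin 3), b)) h
  have h1 := congrArg (fun d => d ((1 : Fin 3), c)) h
  simp only [mono_apply] at h2 h0 h1
  simp only [Fin.isValue, and_true, true_and, Fin.reduceEq, false_and, if_false, add_zero, zero_add,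
    if_true] at h2 h0 h1
  split_ifs at h2 h0 h1; simp_all

/-- **The monomials of weight `(1,1,1)` are exactly the `z_a x_b y_c`.** [folklore] -/
theorem exists_mono_of_weight {d : Var →₀ ℕ} (hd : Finsupp.weight wt d = m111) :
    ∃ τ : P3 × P3 × P3, d = μ[τ.1, τ.2.1, τ.2.2] := by
  classical
  have hl : ∀ l : Fin 3, ∑ q : P3, d (l, q) = 1 := fun l => by
    rw [← weight_wt_apply, hd]
    fin_cases l <;> rfl
  obtain ⟨a, ha⟩ := exists_of_sum_eq_one (hl 2)
  obtain ⟨b, hb⟩ := exists_of_sum_eq_one (hl 0)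
  obtain ⟨c, hc⟩ := exists_of_sum_eq_one (hl 1)
  refine ⟨(a, b, c), Finsupp.ext fun ⟨l, q⟩ => ?_⟩
  rw [mono_apply]
  have h3 : l = 0 ∨ l = 1 ∨ l = 2 := by fin_cases l <;> simp
  rcases h3 with rfl | rfl | rfl
  · rw [hb]; simp
  · rw [hc]; simp
  · rw [ha]; simp

/-- A `(1,1,1)`-form is the sum of its `z_a x_b y_c`-terms (any coefficient ring). [folklore] -/
theorem eq_sum_mono {R : Type*} [CommSemiring R] {F : MvPolynomial Var R}
    (hF : F ∈ MvPolynomial.weightedHomogeneousSubmodule R wt m111) :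
    F = ∑ τ : P3 × P3 × P3, MvPolynomial.monomial μ[τ.1, τ.2.1, τ.2.2]
      (MvPolynomial.coeff μ[τ.1, τ.2.1, τ.2.2] F) := by
  classical
  ext e
  rw [MvPolynomial.coeff_sum]
  simp only [MvPolynomial.coeff_monomial]
  by_cases he : MvPolynomial.coeff e F = 0
  · rw [he]
    symm
    refine Finset.sum_eq_zero fun τ _ => ?_
    split_ifs with h
    · rw [← h] at he; exact he
    · rfl
  · obtain ⟨τ₀, rfl⟩ := exists_mono_of_weight (hF he)
    rw [Finset.sum_eq_single τ₀]
    · simp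
    · intro τ _ hτ
      rw [if_neg]
      intro h
      obtain ⟨h1, h2, h3⟩ := mono_injective h
      exact hτ (Prod.ext h1 (Prod.ext h2 h3))
    · intro h; exact absurd (Finset.mem_univ _) h

/-- `z_a x_b y_c` evaluated. [folklore] -/
theorem eval_monomial_mono {R : Type*} [CommSemiring R] (P : Var → R) (a b c : P3) (co : R) :
    MvPolynomial.eval P (MvPolynomial.monomial μ[a, b, c] co) = co * (P (2, a) * P (0, b) * P (1, c)) := by
  have : MvPolynomial.monomial μ[a, b, c] co =
      MvPolynomial.C co * MvPolynomial.X ((2 : Fin 3), a) * MvPolynomial.X ((0 : Fin 3), b) *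
        MvPolynomial.X ((1 : Fin 3), c) := by
    simp only [MvPolynomial.X, MvPolynomial.C_mul_monomial, MvPolynomial.monomial_mul, mul_one]
  rw [this]
  simp only [map_mul, MvPolynomial.eval_C, MvPolynomial.eval_X]
  ring

/-! ## Apolarity survives the limit -/

/-- **`⟨f, t⟩ = 0` for `f ∈ I_{111}`** (CHL §2.3 (i): `I ⊆ Ann t`): a `(1,1,1)`-form `F(ε)` vanishing at
the moving points of an order-`h` approximate decomposition of `t` has `∑_ρ F(ε)(p_ρ) =
⟨F(ε), ε^h t + O(ε^{h+1})⟩ = 0`, whose `ε^h`-coefficient is `⟨F(0), t⟩`.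
[cite: ConnerHarperLandsberg2023, §2.3 (i)] -/
theorem tPair_eq_zero_of_mem_Ilim {t : P3 → P3 → P3 → ℂ} {r h : ℕ} {p : Fin r → Var → ℂ[X]}
    (hd : IsApproxDecomposition h t (fun ρ a => p ρ (2, a)) (fun ρ b => p ρ (0, b))
      (fun ρ c => p ρ (1, c)))
    {f : Poly} (hf : f ∈ Ilim ℂ wt m111 p) : tPair t f = 0 := by
  classical
  obtain ⟨F, hF, hF0, rfl⟩ := (mem_Ilim_iff sum_wt).1 hf
  choose Q hQ using isApproxDecomposition_iff.1 hd
  set c : P3 × P3 × P3 → ℂ[X] := fun τ => MvPolynomial.coeff μ[τ.1, τ.2.1, τ.2.2] F with hc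
  have hev : ∀ ρ, MvPolynomial.eval (p ρ) F =
      ∑ τ, c τ * (p ρ (2, τ.1) * p ρ (0, τ.2.1) * p ρ (1, τ.2.2)) := by
    intro ρ
    conv_lhs => rw [eq_sum_mono hF]
    rw [map_sum]
    exact Finset.sum_congr rfl fun τ _ => eval_monomial_mono _ _ _ _ _
  have hsum : (X : ℂ[X]) ^ h * ∑ τ, c τ * Q τ.1 τ.2.1 τ.2.2 = 0 := by
    calc (X : ℂ[X]) ^ h * ∑ τ, c τ * Q τ.1 τ.2.1 τ.2.2
        = ∑ τ, c τ * ∑ ρ, p ρ (2, τ.1) * p ρ (0, τ.2.1) * p ρ (1, τ.2.2) := by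
          rw [Finset.mul_sum]
          refine Finset.sum_congr rfl fun τ _ => ?_
          rw [(hQ τ.1 τ.2.1 τ.2.2).1]; ring
      _ = ∑ ρ, MvPolynomial.eval (p ρ) F := by
          simp only [hev, Finset.mul_sum]
          rw [Finset.sum_comm]
      _ = 0 := Finset.sum_eq_zero fun ρ _ => hF0 ρ
  have hsum' : ∑ τ, c τ * Q τ.1 τ.2.1 τ.2.2 = 0 :=
    (mul_eq_zero.1 hsum).resolve_left (pow_ne_zero _ X_ne_zero)
  have h0 := congrArg (fun P : ℂ[X] => P.coeff 0) hsum'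
  simp only [finsetSum_coeff, mul_coeff_zero, coeff_zero] at h0
  have h0' : ∑ τ : P3 × P3 × P3, (c τ).coeff 0 * t τ.1 τ.2.1 τ.2.2 = 0 := by
    rw [← h0]
    exact Finset.sum_congr rfl fun τ _ => by rw [(hQ τ.1 τ.2.1 τ.2.2).2]
  rw [Fintype.sum_prod_type (α₁ := P3) (α₂ := P3 × P3)] at h0'
  simp_rw [Fintype.sum_prod_type (α₁ := P3) (α₂ := P3)] at h0'
  unfold tPair
  refine (Finset.sum_congr rfl fun a _ => Finset.sum_congr rfl fun b _ =>
    Finset.sum_congr rfl fun c' _ => ?_).trans h0'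
  rw [MvPolynomial.coeff_map]
  rfl

/-! ## The theorem -/

/-- Rewriting helper: `I_d · S_e ≤ I_{m'}` for `d + e = m'`. [folklore] -/
theorem Ilim_mul_S_le {r : ℕ} (p : Fin r → Var → ℂ[X]) {d e m' : MDeg} (h : d + e = m') :
    Ilim ℂ wt d p * S e ≤ Ilim ℂ wt m' p :=
  h ▸ Ilim_mul_le sum_wt d e

/-- Rewriting helper: `I_d · I_e ≤ J_{m'}` for `d + e = m'`. [folklore] -/
theorem Ilim_mul_Ilim_le' {r : ℕ} (p : Fin r → Var → ℂ[X]) {d e m' : MDeg} (h : d + e = m') :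
    Ilim ℂ wt d p * Ilim ℂ wt e p ≤ Jlim ℂ wt m' p :=
  h ▸ Ilim_mul_Ilim_le sum_wt d e

/-- Monotonicity helper for the dimension counts. [folklore] -/
theorem finrank_add_le_of_le {A B : Submodule ℂ Poly} (hBf : Module.Finite ℂ B) (hAB : A ≤ B)
    {k n : ℕ} (hB : finrank ℂ B + k ≤ n) : finrank ℂ A + k ≤ n :=
  (Nat.add_le_add_right (Submodule.finrank_mono hAB) k).trans hB

/-- **`stub_fatBorderApolarity` — FAT (symbolic-square) BORDER APOLARITY, truncated at total degree 4.**
If `R̲(t) ≤ r` and `x` is a configuration of `r` points in general position, then `t` admits a fat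
border-apolarity candidate for `r`: the limits `I_m = lim_{ε→0} I(Γ_ε)_m` of the multigraded ideal of
the `r` moving points of a border rank decomposition, perturbed towards `x`.
[cite: ConnerHarperLandsberg2023, §2.3 (i)–(iii)] -/
theorem stub_fatBorderApolarity : ∀ (t : P3 → P3 → P3 → ℂ) (r : ℕ) (x : Fin r → Var → ℂ),
    GeneralConfiguration r x → algBorderRank t ≤ r →
      ∃ I : MDeg → Submodule ℂ Poly, IsFatCandidate t r I := by
  intro t r x hx hbr
  classical
  -- an order-`h` approximate decomposition with `r` triads, and its moving points in `Poly`-coordinates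
  obtain ⟨h, hh⟩ := exists_algBorderRank_eq_approxRank t
  have hhr : approxRank h t ≤ r := hh ▸ hbr
  obtain ⟨u, v, w, hd⟩ := exists_isApproxDecomposition_of_approxRank_le hhr
  let q : Fin r → Var → ℂ[X] := fun ρ s => ![v ρ s.2, w ρ s.2, u ρ s.2] s.1
  -- perturb towards `x` beyond all degrees
  obtain ⟨M, hMh, hqM⟩ : ∃ M : ℕ, h < M ∧ ∀ ρ s, (q ρ s).natDegree < M := by
    refine ⟨max h (Finset.univ.sup fun z : Fin r × Var => (q z.1 z.2).natDegree) + 1,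
      by omega, fun ρ s => ?_⟩
    have := Finset.le_sup (f := fun z : Fin r × Var => (q z.1 z.2).natDegree) (Finset.mem_univ (ρ, s))
    simp only at this
    omega
  let p : Fin r → Var → ℂ[X] := fun ρ s => q ρ s + X ^ M * C (x ρ s)
  have hd' : IsApproxDecomposition h t (fun ρ a => p ρ (2, a)) (fun ρ b => p ρ (0, b))
      (fun ρ c => p ρ (1, c)) :=
    isApproxDecomposition_add_X_pow_mul hd hMh _ _ _
  -- dimension counts
  have hdeg : ∀ m ∈ degsData ++ degs4, finrank ℂ ↥(Ilim ℂ wt m p) + r = finrank ℂ ↥(S m) :=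
    fun m hm => finrank_Ilim_add (w := wt) (m := m) sum_wt hqM (hx.1 m hm)
  have hmul : ∀ {m : MDeg} {f g : Poly}, f ∈ Ilim ℂ wt m p → g ∈ S (fun s => 1 - m s) →
      (m + fun s => 1 - m s) = m111 → f * g ∈ Ilim ℂ wt m111 p :=
    fun hf hg hm => Ilim_mul_S_le p hm (Submodule.mul_mem_mul hf hg)
  have room : ∀ (A : Submodule ℂ Poly) (m' : MDeg), m' ∈ degs4 → A ≤ Ilim ℂ wt m' p →
      finrank ℂ ↥A + r ≤ finrank ℂ ↥(S m') := fun A m' hm' hA =>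
    finrank_add_le_of_le (finite_Ilim p) hA (hdeg m' (List.mem_append_right _ hm')).le
  have fat : ∀ (A : Submodule ℂ Poly) (m' : MDeg) (k : ℕ),
      finrank ℂ ↥(dpSub m' x) + k ≤ finrank ℂ ↥(S m') → A ≤ Jlim ℂ wt m' p →
      finrank ℂ ↥A + k ≤ finrank ℂ ↥(S m') := fun A m' k hk hA =>
    finrank_add_le_of_le (finite_Jlim p) hA (finrank_Jlim_add_le (w := wt) (m := m') sum_wt hqM hk)
  refine ⟨fun m => Ilim ℂ wt m p, ?_, ?_, ?_, ?_, ?_⟩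
  · -- (deg)
    exact fun m hm => ⟨Ilim_le, hdeg m (List.mem_append_left _ hm)⟩
  · -- (apolar)
    refine ⟨fun f hf g hg => ?_, fun f hf g hg => ?_, fun f hf g hg => ?_, fun f hf g hg => ?_⟩ <;>
      exact tPair_eq_zero_of_mem_Ilim hd' (hmul hf hg (by decide))
  · -- (mult)
    exact ⟨Ilim_mul_S_le p (by decide), Ilim_mul_S_le p (by decide), Ilim_mul_S_le p (by decide),
      Ilim_mul_S_le p (by decide), Ilim_mul_S_le p (by decide), Ilim_mul_S_le p (by decide),
      Ilim_mul_S_le p (by decide), Ilim_mul_S_le p (by decide), Ilim_mul_S_le p (by decide),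
      Ilim_mul_S_le p (by decide), Ilim_mul_S_le p (by decide), Ilim_mul_S_le p (by decide),
      Ilim_mul_S_le p (by decide), Ilim_mul_S_le p (by decide), Ilim_mul_S_le p (by decide)⟩
  · -- (room)
    refine ⟨room _ m310 (by simp [degs4]) (Ilim_mul_S_le p (by decide)),
      room _ m130 (by simp [degs4]) (Ilim_mul_S_le p (by decide)),
      room _ m301 (by simp [degs4]) (Ilim_mul_S_le p (by decide)),
      room _ m103 (by simp [degs4]) (Ilim_mul_S_le p (by decide)),
      room _ m031 (by simp [degs4]) (Ilim_mul_S_le p (by decide)),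
      room _ m013 (by simp [degs4]) (Ilim_mul_S_le p (by decide)),
      room _ m220 (by simp [degs4]) (sup_le (Ilim_mul_S_le p (by decide)) (Ilim_mul_S_le p (by decide))),
      room _ m202 (by simp [degs4]) (sup_le (Ilim_mul_S_le p (by decide)) (Ilim_mul_S_le p (by decide))),
      room _ m022 (by simp [degs4]) (sup_le (Ilim_mul_S_le p (by decide)) (Ilim_mul_S_le p (by decide))),
      room _ m211 (by simp [degs4]) (sup_le (sup_le (Ilim_mul_S_le p (by decide))
        (Ilim_mul_S_le p (by decide))) (Ilim_mul_S_le p (by decide))),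
      room _ m121 (by simp [degs4]) (sup_le (sup_le (Ilim_mul_S_le p (by decide))
        (Ilim_mul_S_le p (by decide))) (Ilim_mul_S_le p (by decide))),
      room _ m112 (by simp [degs4]) (sup_le (sup_le (Ilim_mul_S_le p (by decide))
        (Ilim_mul_S_le p (by decide))) (Ilim_mul_S_le p (by decide)))⟩
  · -- (fat)
    obtain ⟨-, h17, h25⟩ := hx
    refine ⟨fat _ m310 _ (h17 _ (by simp)) (Ilim_mul_Ilim_le' p (by decide)),
      fat _ m130 _ (h17 _ (by simp)) (Ilim_mul_Ilim_le' p (by decide)),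
      fat _ m301 _ (h17 _ (by simp)) (Ilim_mul_Ilim_le' p (by decide)),
      fat _ m103 _ (h17 _ (by simp)) (Ilim_mul_Ilim_le' p (by decide)),
      fat _ m031 _ (h17 _ (by simp)) (Ilim_mul_Ilim_le' p (by decide)),
      fat _ m013 _ (h17 _ (by simp)) (Ilim_mul_Ilim_le' p (by decide)),
      fat _ m220 _ (h17 _ (by simp)) (sup_le (Ilim_mul_Ilim_le' p (by decide))
        (Ilim_mul_Ilim_le' p (by decide))),
      fat _ m202 _ (h17 _ (by simp)) (sup_le (Ilim_mul_Ilim_le' p (by decide))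
        (Ilim_mul_Ilim_le' p (by decide))),
      fat _ m022 _ (h17 _ (by simp)) (sup_le (Ilim_mul_Ilim_le' p (by decide))
        (Ilim_mul_Ilim_le' p (by decide))),
      fat _ m211 _ (h25 _ (by simp)) (sup_le (Ilim_mul_Ilim_le' p (by decide))
        (Ilim_mul_Ilim_le' p (by decide))),
      fat _ m121 _ (h25 _ (by simp)) (sup_le (Ilim_mul_Ilim_le' p (by decide))
        (Ilim_mul_Ilim_le' p (by decide))),
      fat _ m112 _ (h25 _ (by simp)) (sup_le (Ilim_mul_Ilim_le' p (by decide))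
        (Ilim_mul_Ilim_le' p (by decide)))⟩

end Summit.MatrixMultiplication.MatrixMultiplication.Theorems.SymbolicSquare

end
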